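import Summits.QuantumAdvantage.AdviceFreeQNC0.TensorLPInduction
import Summits.QuantumAdvantage.AdviceFreeQNC0.TensorMultAtUpperBound
import Summits.QuantumAdvantage.AdviceFreeQNC0.MassInequalityK
import HarnessLib

/-!
# Cell qa-qnc0 (rung F-Q1, density axis): the PRODUCT (OR) CONSTRUCTION at every tower level —
# `W_k(m,1) ≤ w_sym(m)^k`, the upper half of exact tensor multiplicativity (planner qa-qnc0-p1 TARGET §16.3/§25)

Planner qa-qnc0-p1 (ROUND-12 §2.10, (xi-q) "EXACT tensor multiplicativity `W_k(m,1) = w(m,1)^k` at m = 5, 6, 7").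
The LOWER half `W_k ≥ w^k` is kernel (`tensorMultAt_six/seven`, `exactMultSeven`); this file gives the UPPER
half for every `k` by the OR-construction: if `win_k` is a `k`-block sum-code element on `{0,1}^{mk}` and `X`
a one-block even eliminator triple, then `win_{k+1}(v ++ u) := win_k(v) ∨ X(u)` is a `(k+1)`-block sum-code
element (`win_k ⊕ [X(u) ∧ ¬win_k(v)]`, the last term being a block-`k` even triple `T_r(u) ∧ ¬win_k(v)`),
and it fails exactly when both fail: `#FAIL(win_{k+1}) = #FAIL(win_k) · #FAIL(X)`.  With the symmetric triple
of `TensorMultAtUpperBound.lean` (`#FAIL = N6 m jₑ + N6 m jₒ`):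

* `TensorOR.exists_sumCodeWin_failCount_pow`: for every `k` there is an element of the `k`-block degree-1 sum
  code on `{0,1}^{mk}` failing on exactly `(N6 m jₑ + N6 m jₒ)^k` inputs (`jₑ ∈ {0,2,4}`, `jₒ ∈ {1,3,5}`);
* **`tensorMultAt_pow_le`**: `TensorMultAt m 1 β → 0 ≤ β → ∀ k, (β·2^m)^k ≤ (N6 m jₑ + N6 m jₒ)^k`; in
  particular the ratio of `exactMultSeven` is tight at EVERY level: `W_k(7,1) ≤ 16^k` (`failCount_pow_seven`).

The cell's statements (not in print).  WHAT THIS IS NOT: optimality of the symmetric triple among all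
one-block triples (`w_sym = w`, qn-lit's `SymmetricOptima`) is not used or claimed; separation NOT moved.
-/

noncomputable section

namespace Summit.QuantumAdvantage.AdviceFreeQNC0

open Finset
open Literature.Computability.MetaComplexity Literature.Computability.MetaComplexity.Smolensky
open DiversityRungs TensorLP TensorUB MassInequality

namespace TensorOR

variable {m k : ℕ}

/-- Restriction to the leading `mk` coordinates. -/
def lead (w : Fin (m * k + m) → Bool) : Fin (m * k) → Bool := fun i => w (Fin.castAdd m i)

/-- Restriction to the last block. -/
def lastB (w : Fin (m * k + m) → Bool) : Fin m → Bool := fun i => w (Fin.natAdd (m * k) i)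

/-- `lead (v ++ u) = v`. -/
@[simp] theorem lead_append (v : Fin (m * k) → Bool) (u : Fin m → Bool) : lead (Fin.append v u) = v := by
  funext i; simp [lead]

/-- `lastB (v ++ u) = u`. -/
@[simp] theorem lastB_append (v : Fin (m * k) → Bool) (u : Fin m → Bool) : lastB (Fin.append v u) = u := by
  funext i; simp [lastB]

/-- Precomposition with `lead` keeps the degree (substitution lemma). -/
theorem hasDeg_comp_lead {D : ℕ} {f : (Fin (m * k) → Bool) → Bool} (hf : HasDeg f D) :
    HasDeg (fun w : Fin (m * k + m) → Bool => f (lead w)) D :=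
  comp_subst_mem_lowDeg (fun w : Fin (m * k + m) → Bool => lead w) (fun i => Or.inr ⟨Fin.castAdd m i, fun _ => rfl⟩) hf

/-- Precomposition with `lastB` keeps the degree (substitution lemma). -/
theorem hasDeg_comp_lastB {D : ℕ} {f : (Fin m → Bool) → Bool} (hf : HasDeg f D) :
    HasDeg (fun w : Fin (m * k + m) → Bool => f (lastB w)) D :=
  comp_subst_mem_lowDeg (fun w : Fin (m * k + m) → Bool => lastB w) (fun i => Or.inr ⟨Fin.natAdd (m * k) i, fun _ => rfl⟩) hf

/-- AND with a constant keeps the degree. -/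
theorem hasDeg_and_const {n D : ℕ} {f : (Fin n → Bool) → Bool} (hf : HasDeg f D) (b : Bool) :
    HasDeg (fun w => f w && b) D := by
  cases b
  · have : (fun w => f w && false) = fun _ => false := funext fun w => Bool.and_false _
    rw [this]; unfold HasDeg
    have h0 : (fun x : Fin n → Bool => if false = true then (1 : ZMod 2) else 0) = 0 := funext fun _ => by simp
    rw [h0]; exact Submodule.zero_mem _
  · have : (fun w => f w && true) = f := funext fun w => Bool.and_true _
    rw [this]; exact hf

/-- `mergeBlock` on a leading block commutes with `lead`. -/
theorem lead_mergeBlock (j : ℕ) (V W : Fin (m * k + m) → Bool) :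
    lead (mergeBlock (m * k + m) (k + 1) j V W) = mergeBlock (m * k) k j (lead V) (lead W) := by
  funext i; simp only [lead, mergeBlock, blockIdx_castAdd']

/-- `mergeBlock` on a leading block does not touch the last block. -/
theorem lastB_mergeBlock_lt {j : ℕ} (hj : j < k) (V W : Fin (m * k + m) → Bool) :
    lastB (mergeBlock (m * k + m) (k + 1) j V W) = lastB V := by
  funext i; simp only [lastB, mergeBlock, blockIdx_natAdd, if_neg (Nat.ne_of_gt hj)]

/-- `mergeBlock` on the last block: leading part from `V`, last block from `W`. -/
theorem lead_mergeBlock_last (V W : Fin (m * k + m) → Bool) :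
    lead (mergeBlock (m * k + m) (k + 1) k V W) = lead V := by
  funext i; simp only [lead, mergeBlock, blockIdx_castAdd, if_neg (Nat.ne_of_lt (div_lt_of_fin i))]

/-- `mergeBlock` on the last block: last block from `W`. -/
theorem lastB_mergeBlock_last (V W : Fin (m * k + m) → Bool) :
    lastB (mergeBlock (m * k + m) (k + 1) k V W) = lastB W := by
  funext i; simp only [lastB, mergeBlock, blockIdx_natAdd, if_true]

/-- A vector of the big cube is `lead ++ lastB`. -/
theorem append_lead_lastB (w : Fin (m * k + m) → Bool) : Fin.append (lead w) (lastB w) = w := by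
  funext x
  induction x using Fin.addCases with
  | left i => simp [lead]
  | right i => simp [lastB]

/-- Block weights of leading blocks are read off `lead`. -/
theorem blockWt_lead {j : ℕ} (hj : j < k) (w : Fin (m * k + m) → Bool) :
    blockWt (m * k + m) (k + 1) j w = blockWt (m * k) k j (lead w) := by
  conv_lhs => rw [← append_lead_lastB w]
  exact blockWt_append_lt hj _ _

/-- The block weight of the last block is `wt (lastB w)`. -/
theorem blockWt_last (w : Fin (m * k + m) → Bool) : blockWt (m * k + m) (k + 1) k w = wt (lastB w) := by
  conv_lhs => rw [← append_lead_lastB w]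
  exact blockWt_append_last _ _

/-- Extending a leading-block even triple by ignoring the last block. -/
theorem isBlockElim_extend {j : ℕ} (hj : j < k) {X : (Fin (m * k) → Bool) → Bool}
    (hX : IsBlockElim (m * k) k j 1 X) : IsBlockElim (m * k + m) (k + 1) j 1 (fun w => X (lead w)) := by
  obtain ⟨T, hT, hTe, hTX⟩ := hX
  refine ⟨fun r w => T r (lead w), fun r V => ?_, fun w => hTe (lead w), fun w => ?_⟩
  · show HasDeg (fun W => T r (lead (mergeBlock (m * k + m) (k + 1) j V W))) 1
    simp only [lead_mergeBlock j]
    exact hasDeg_comp_lead (hT r (lead V))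
  · show X (lead w) = T (blockWt (m * k + m) (k + 1) j w % 3) (lead w)
    rw [hTX, blockWt_lead hj]

/-- The OR-step term: `T_{|u| mod 3}(u) ∧ h(v)` for a one-block even triple `T` and any `h` on the lead. -/
theorem isBlockElim_last {X : (Fin m → Bool) → Bool} (hX : IsElim1 m X) (h : (Fin (m * k) → Bool) → Bool) :
    IsBlockElim (m * k + m) (k + 1) k 1 (fun w => X (lastB w) && h (lead w)) := by
  obtain ⟨T, hT, hTe, hTX⟩ := hX
  refine ⟨fun r w => T r (lastB w) && h (lead w), fun r V => ?_, fun w => ?_, fun w => ?_⟩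
  · show HasDeg (fun W => T r (lastB (mergeBlock (m * k + m) (k + 1) k V W)) &&
      h (lead (mergeBlock (m * k + m) (k + 1) k V W))) 1
    simp only [lastB_mergeBlock_last, lead_mergeBlock_last]
    exact hasDeg_and_const (hasDeg_comp_lastB (hT r)) _
  · show xor (T 0 (lastB w) && h (lead w)) (xor (T 1 (lastB w) && h (lead w)) (T 2 (lastB w) && h (lead w))) = false
    have := hTe (lastB w)
    revert this
    cases T 0 (lastB w) <;> cases T 1 (lastB w) <;> cases T 2 (lastB w) <;> cases h (lead w) <;> decide
  · show (X (lastB w) && h (lead w)) = (T (blockWt (m * k + m) (k + 1) k w % 3) (lastB w) && h (lead w))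
    rw [hTX, blockWt_last]

/-- **The OR-step**: `win ∨ X` (win on the lead, `X ∈ C_m` on the last block) is a `(k+1)`-block sum-code element. -/
theorem sumCodeWin_or {win : (Fin (m * k) → Bool) → Bool} (hwin : SumCodeWin (m * k) k 1 win)
    {X : (Fin m → Bool) → Bool} (hX : IsElim1 m X) :
    SumCodeWin (m * k + m) (k + 1) 1 (fun w => win (lead w) || X (lastB w)) := by
  obtain ⟨Xs, hXs, hw⟩ := hwin
  refine ⟨fun j w => if j < k then Xs j (lead w) else X (lastB w) && !win (lead w), fun j hj => ?_, fun w => ?_⟩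
  · by_cases hjk : j < k
    · simp only [hjk, if_true]; exact isBlockElim_extend hjk (hXs j hjk)
    · have hj' : j = k := by omega
      subst hj'
      simp only [lt_irrefl, if_false]
      exact isBlockElim_last hX (fun v => !win v)
  · rw [decide_range_succ]
    simp only [lt_irrefl, if_false]
    have e : (((range k).filter fun j => (if j < k then Xs j (lead w) else X (lastB w) && !win (lead w)) = true)) =
        (range k).filter fun j => Xs j (lead w) = true :=
      filter_congr fun j hj => by rw [if_pos (mem_range.1 hj)]
    rw [e, ← hw (lead w)]
    cases win (lead w) <;> cases X (lastB w) <;> rfl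

/-- **Failure count of the OR**: both must fail. -/
theorem failCount_or (win : (Fin (m * k) → Bool) → Bool) (X : (Fin m → Bool) → Bool) :
    failCount (fun w : Fin (m * k + m) → Bool => win (lead w) || X (lastB w)) = failCount win * failCount X := by
  classical
  rw [TensorBlocksFixed.failCount_eq_sum_append (M := m * k) (r := m)]
  simp only [lead_append, lastB_append]
  unfold failCount
  rw [Finset.card_filter (fun u : Fin m → Bool => X u = false), Finset.mul_sum]
  refine sum_congr rfl fun u _ => ?_
  cases X u <;> simp

/-- **At every level there is a sum-code element failing on exactly `(#FAIL X)^k` inputs**, for any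
one-block even triple `X`. -/
theorem exists_failCount_pow {X : (Fin m → Bool) → Bool} (hX : IsElim1 m X) :
    ∀ k : ℕ, ∃ win : (Fin (m * k) → Bool) → Bool, SumCodeWin (m * k) k 1 win ∧ failCount win = failCount X ^ k
  | 0 => ⟨fun _ => false, sumCode_false m 0, by
      unfold failCount
      rw [filter_true_of_mem fun u _ => rfl, card_univ, Fintype.card_fun, Fintype.card_bool, Fintype.card_fin]
      simp⟩
  | k + 1 => by
      obtain ⟨win, hwin, hf⟩ := exists_failCount_pow hX k
      refine ⟨fun w => win (lead w) || X (lastB w), sumCodeWin_or hwin hX, ?_⟩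
      show failCount (fun w : Fin (m * k + m) → Bool => win (lead w) || X (lastB w)) = failCount X ^ (k + 1)
      rw [failCount_or, hf, pow_succ]

end TensorOR

open TensorOR

/-- The symmetric triple of `TensorMultAtUpperBound` as a one-block codeword on `{0,1}^m` with the prescribed
failure count `N6 m jₑ + N6 m jₒ`. -/
theorem exists_isElim1_failCount_sym (m : ℕ) {je jo : ℕ} (hje : je = 0 ∨ je = 2 ∨ je = 4)
    (hjo : jo = 1 ∨ jo = 3 ∨ jo = 5) :
    ∃ X : (Fin m → Bool) → Bool, IsElim1 m X ∧ failCount X = N6 m je + N6 m jo := by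
  -- reuse the `k = 1` statement of `tensorMultAt_one_le`'s construction through `TensorMultAt m 1 β` at β = f/2^m?
  -- Direct construction: the symmetric pattern on `Fin m` (as `Fin (m*1)`-free version).
  classical
  obtain ⟨a₀, a₁, hev⟩ : ∃ a₀ a₁ : Bool, ∀ j, (j = 0 ∨ j = 2 ∨ j = 4) →
      ((if j % 3 = 0 then a₀ else if j % 3 = 1 then a₁ else xor a₀ a₁) = false ↔ j = je) := by
    rcases hje with rfl | rfl | rfl
    · exact ⟨false, true, fun j hj => by rcases hj with rfl | rfl | rfl <;> decide⟩
    · exact ⟨true, true, fun j hj => by rcases hj with rfl | rfl | rfl <;> decide⟩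
    · exact ⟨true, false, fun j hj => by rcases hj with rfl | rfl | rfl <;> decide⟩
  obtain ⟨c₀, c₁, hod⟩ : ∃ c₀ c₁ : Bool, ∀ j, (j = 1 ∨ j = 3 ∨ j = 5) →
      ((if j % 3 = 0 then c₀ else if j % 3 = 1 then c₁ else xor c₀ c₁) = false ↔ j = jo) := by
    rcases hjo with rfl | rfl | rfl
    · exact ⟨true, false, fun j hj => by rcases hj with rfl | rfl | rfl <;> decide⟩
    · exact ⟨false, true, fun j hj => by rcases hj with rfl | rfl | rfl <;> decide⟩
    · exact ⟨true, true, fun j hj => by rcases hj with rfl | rfl | rfl <;> decide⟩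
  set b₀ := xor a₀ c₀ with hb₀
  set b₁ := xor a₁ c₁ with hb₁
  have hdeg : ∀ r, HasDeg (symT (n := m) a₀ b₀ a₁ b₁ r) 1 := by
    intro r
    unfold symT
    by_cases h0 : r = 0
    · simp only [h0, if_true]; exact hasDeg_affSym a₀ b₀
    · by_cases h1 : r = 1
      · simp only [h1, if_true, show (1 : ℕ) ≠ 0 from one_ne_zero, if_false]; exact hasDeg_affSym a₁ b₁
      · simp only [h0, h1, if_false]; exact hasDeg_xor (hasDeg_affSym a₀ b₀) (hasDeg_affSym a₁ b₁)
  have heven : ∀ u : Fin m → Bool,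
      xor (symT a₀ b₀ a₁ b₁ 0 u) (xor (symT a₀ b₀ a₁ b₁ 1 u) (symT a₀ b₀ a₁ b₁ 2 u)) = false := by
    intro u
    unfold symT
    simp only [if_true, show (1 : ℕ) ≠ 0 from one_ne_zero, if_false, show (2 : ℕ) ≠ 0 from two_ne_zero,
      show (2 : ℕ) ≠ 1 from by norm_num]
    cases affSym a₀ b₀ u <;> cases affSym a₁ b₁ u <;> rfl
  refine ⟨symPat a₀ b₀ a₁ b₁, ⟨symT a₀ b₀ a₁ b₁, hdeg, heven, fun u => rfl⟩, ?_⟩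
  · have hval : ∀ j < 6, (symVal a₀ b₀ a₁ b₁ j = false ↔ j = je ∨ j = jo) := by
      intro j hj
      have hcases : (j = 0 ∨ j = 2 ∨ j = 4) ∨ (j = 1 ∨ j = 3 ∨ j = 5) := by omega
      rcases hcases with hj' | hj'
      · have hp : decide (j % 2 = 1) = false := by rcases hj' with rfl | rfl | rfl <;> decide
        have hne : j ≠ jo := by rcases hj' with rfl | rfl | rfl <;> rcases hjo with rfl | rfl | rfl <;> omega
        unfold symVal
        simp only [hp, Bool.and_false, Bool.xor_false]
        rw [hev j hj']
        exact ⟨Or.inl, fun h => h.elim id fun h => absurd h hne⟩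
      · have hp : decide (j % 2 = 1) = true := by rcases hj' with rfl | rfl | rfl <;> decide
        have hne : j ≠ je := by rcases hj' with rfl | rfl | rfl <;> rcases hje with rfl | rfl | rfl <;> omega
        have e₀ : xor a₀ (b₀ && true) = c₀ := by rw [Bool.and_true, hb₀]; cases a₀ <;> cases c₀ <;> rfl
        have e₁ : xor a₁ (b₁ && true) = c₁ := by rw [Bool.and_true, hb₁]; cases a₁ <;> cases c₁ <;> rfl
        unfold symVal
        simp only [hp, e₀, e₁]
        rw [hod j hj']
        exact ⟨Or.inr, fun h => h.elim (fun h => absurd h hne) id⟩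
    have hfilter : (range 6).filter (fun j => symVal a₀ b₀ a₁ b₁ j = false) = {je, jo} := by
      ext j
      simp only [mem_filter, mem_range, mem_insert, mem_singleton]
      constructor
      · rintro ⟨hj, h⟩; exact (hval j hj).1 h
      · intro h
        have hj : j < 6 := by rcases h with rfl | rfl <;> omega
        exact ⟨hj, (hval j hj).2 h⟩
    have hne : je ≠ jo := by rcases hje with rfl | rfl | rfl <;> rcases hjo with rfl | rfl | rfl <;> omega
    rw [failCount_symPat, hfilter, sum_pair hne]

/-- **At every tower level the `k`-block degree-1 sum code on `{0,1}^{mk}` has an element failing on exactly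
`(N6 m jₑ + N6 m jₒ)^k` inputs** (`jₑ ∈ {0,2,4}`, `jₒ ∈ {1,3,5}`): the product (OR) construction. -/
theorem exists_sumCodeWin_failCount_pow (m : ℕ) {je jo : ℕ} (hje : je = 0 ∨ je = 2 ∨ je = 4)
    (hjo : jo = 1 ∨ jo = 3 ∨ jo = 5) (k : ℕ) :
    ∃ win : (Fin (m * k) → Bool) → Bool, SumCodeWin (m * k) k 1 win ∧ failCount win = (N6 m je + N6 m jo) ^ k := by
  obtain ⟨X, hX, hf⟩ := exists_isElim1_failCount_sym m hje hjo
  obtain ⟨win, hwin, hwf⟩ := exists_failCount_pow hX k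
  exact ⟨win, hwin, by rw [hwf, hf]⟩

/-- **Upper bound at every level**: `TensorMultAt m 1 β` with `β ≥ 0` forces `(β·2^m)^k ≤ (N6 m jₑ + N6 m jₒ)^k`
for all `k` — the ratio can never exceed the symmetric product value at ANY tower level. -/
theorem tensorMultAt_pow_le {m : ℕ} {β : ℝ} (hT : TensorMultAt m 1 β) {je jo : ℕ}
    (hje : je = 0 ∨ je = 2 ∨ je = 4) (hjo : jo = 1 ∨ jo = 3 ∨ jo = 5) (k : ℕ) (hk : 0 < k) :
    (β * (2 : ℝ) ^ m) ^ k ≤ (((N6 m je + N6 m jo) ^ k : ℕ) : ℝ) := by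
  obtain ⟨win, hwin, hf⟩ := exists_sumCodeWin_failCount_pow m hje hjo k
  have h := hT k hk win hwin
  rw [hf] at h
  exact h

/-- `W_k(7,1) ≤ 16^k` at every level: the ratio `16/2^7` of `exactMultSeven` is attained (the OR-power of the
symmetric triple failing on classes `0` and `1` mod 6, `8 + 8 = 16`). -/
theorem failCount_pow_seven (k : ℕ) :
    ∃ win : (Fin (7 * k) → Bool) → Bool, SumCodeWin (7 * k) k 1 win ∧ failCount win = 16 ^ k := by
  obtain ⟨win, hwin, hf⟩ := exists_sumCodeWin_failCount_pow 7 (je := 0) (jo := 1) (Or.inl rfl) (Or.inl rfl) k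
  refine ⟨win, hwin, ?_⟩
  rw [hf]
  have h0 : N6 7 0 = 8 := by rw [N6_eq_sum_choose]; decide
  have h1 : N6 7 1 = 8 := by rw [N6_eq_sum_choose]; decide
  rw [h0, h1]

end Summit.QuantumAdvantage.AdviceFreeQNC0
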